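import Summits.QuantumFields.YangMills.Theorems.FemtoTransferGapLevelsPos
import HarnessLib

/-!
# The zero-flux transfer spectrum of `SU(2)` Wilson theory is DISCRETE at fixed lattice: `∑_{j≤k} λ_j² ≤ ‖K_β‖_∞²`, `λ_k ≤ ‖K_β‖_∞/√(k+1) → 0`

Support module of the `FemtoTransferGap` group (fleet service by seat ym-infvol-p2; route `LuscherReduction`, bears on crux `RunningReduction`
stmt-QuantumFields-19978 and crux `OneSiteLevels` stmt-QuantumFields-20007).  With the spectral attainment now unconditional
(`exists_isPhys_eigenfamily_dominating_of_pos`, `FemtoTransferGapLevelsPos`), the HILBERT–SCHMIDT bound closes the fixed-lattice picture of the min–max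
transfer values `λ_k(β, L) = levelValue su2Rep L β k`:

* `levelValue_le_of_le` — `λ_·` is non-increasing in the level (from Courant–Fischer domination of the exact eigenfamily; no route import);
* `sum_levelValue_sq_le` — **Bessel / Hilbert–Schmidt**: for the physical `l2`-orthonormal exact eigenfamily `φ₀ … φ_k`, Bessel's inequality in
  `L²(configMeasure)` for the kernel section `K_β(U,·)` reads `∑_j λ_j² φ_j(U)² ≤ ∫ K_β(U,V)² dV ≤ M²` pointwise (`M = sup K_β`,
  `exists_transferKernel_le`); integrating over the probability measure, `∑_{j≤k} λ_j² ≤ M²`;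
* **`succ_mul_levelValue_sq_le`**: `(k+1)·λ_k² ≤ M²`, **`levelValue_le_div_sqrt`**: `λ_k ≤ M/√(k+1)`, and **`tendsto_levelValue_atTop_zero`**: `λ_k → 0` as
  `k → ∞` (`β > 0`) — the zero-flux transfer operator has purely discrete spectrum accumulating only at `0`: together with `0 < λ_k` (`levelValue_su2Rep_pos`),
  `λ₁ < λ₀` (`secondValue_lt_topValue`) and attainment, every excitation energy `E_k = −log(λ_k/λ₀)` is a finite real number and `E_k → ∞`.

HONEST FRAMING: fixed-lattice functional analysis of the femto rung R2b1 (a `3L³`-link compact-group quantum mechanics); nothing here is uniform in `L`,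
infinite volume, a mass gap or Clay.
References: M. Reed, B. Simon I (1980) Thm. VI.22 (Hilbert–Schmidt) [cite: ReedSimonI1980]; IV (1978) XIII.1 [cite: ReedSimonIV1978]; [cite: Luscher1977].
-/

set_option autoImplicit false

noncomputable section

open MeasureTheory Filter Topology Real
open Literature.MathematicalPhysics.QuantumFieldTheory
open Literature.MathematicalPhysics.QuantumLattice
open Literature.Analysis.OperatorTheory.YMMatrixModel
open Literature.Analysis.OperatorTheory
open scoped InnerProductSpace

namespace Summit.QuantumFields.YangMills.Theorems.FemtoTransferGap

open PhysL2

variable {L : ℕ} [NeZero L]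

/-- **`λ_·(β, L)` is non-increasing in the level** (`β > 0`): `j ≤ k ⟹ λ_k ≤ λ_j` — Courant–Fischer domination of the exact eigenfamily
(`exists_isPhys_eigenfamily_dominating_of_pos`) applied to the `k`-th eigenfunction, which is orthogonal to `φ₀ … φ_{j−1}`.  (Route-independent twin of
`KTRCalibration.levelValue_antitone`.) [cite: ReedSimonIV1978, Thm. XIII.1] -/
theorem levelValue_le_of_le {β : ℝ} (hβ : 0 < β) {j k : ℕ} (hjk : j ≤ k) :
    levelValue su2Rep L β k ≤ levelValue su2Rep L β j := by
  obtain ⟨e, he, hon, heig, hdom⟩ := exists_isPhys_eigenfamily_dominating_of_pos (L := L) hβ k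
  have hj : j < k + 1 := Nat.lt_succ_of_le hjk
  -- domination at level `j` applied to the `k`-th eigenfunction
  have h := hdom ⟨j, hj⟩ (e (Fin.last k)) (he _) (fun i hi => by
    rw [hon]
    have hne : Fin.last k ≠ i := by
      intro hki
      have h1 : (i : ℕ) < j := by simpa [Fin.lt_def] using hi
      have h2 : (i : ℕ) = k := by rw [← hki]; simp
      omega
    simp [hne])
  have hq : qform su2Rep β (e (Fin.last k)) (e (Fin.last k)) = levelValue su2Rep L β k := by
    rw [qform_eq_l2_transferApply, heig, l2_comm, l2_smul_left, l2_comm, hon]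
    simp
  have hn : l2 (e (Fin.last k)) (e (Fin.last k)) = 1 := by rw [hon]; simp
  rw [hq, hn, mul_one] at h
  simpa using h

/-- **Hilbert–Schmidt bound (Bessel)**: `∑_{j ≤ k} λ_j(β,L)² ≤ M²` whenever `K_β ≤ M` pointwise (`β > 0`).  For the physical `l2`-orthonormal exact
eigenfamily `φ₀ … φ_k`: `⟨φ_j, K_β(U,·)⟩ = (K_βφ_j)(U) = λ_jφ_j(U)`, so Bessel's inequality in `L²(configMeasure)` gives
`∑_j λ_j² φ_j(U)² ≤ ‖K_β(U,·)‖² ≤ M²` for every `U`; integrate over the probability measure. [cite: ReedSimonI1980, Thm. VI.22] -/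
theorem sum_levelValue_sq_le {β : ℝ} (hβ : 0 < β) {M : ℝ} (hM : ∀ U V : GaugeConfig 3 L SU2, transferKernel su2Rep β U V ≤ M) (k : ℕ) :
    ∑ j : Fin (k + 1), levelValue su2Rep L β j ^ 2 ≤ M ^ 2 := by
  haveI : SecondCountableTopology (Matrix (Fin 2) (Fin 2) ℂ) := inferInstanceAs (SecondCountableTopology (Fin 2 → Fin 2 → ℂ))
  haveI : SecondCountableTopology SU2 := secondCountableTopology_su2
  obtain ⟨e, he, hon, heig⟩ := exists_isPhys_eigenfamily_of_pos (L := L) hβ k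
  have hM0 : 0 ≤ M := (transferKernel_pos su2Rep β (fun _ => 1) (fun _ => 1)).le.trans (hM _ _)
  set μ := configMeasure SU2 L with hμ
  -- the eigenfunctions as an orthonormal family in `L²`
  set v : Fin (k + 1) → Lp ℝ 2 μ := fun j => toL2 ⟨e j, he j⟩ with hv
  have hvon : Orthonormal ℝ v := by
    rw [orthonormal_iff_ite]
    intro i j
    rw [hv, inner_toL2]
    exact hon i j
  -- the kernel section `K(U,·)` as an `L²` class, and Bessel pointwise in `U`
  have hpt : ∀ U : GaugeConfig 3 L SU2, ∑ j : Fin (k + 1), (levelValue su2Rep L β j * e j U) ^ 2 ≤ M ^ 2 := by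
    intro U
    have hKc : Continuous fun V : GaugeConfig 3 L SU2 => transferKernel su2Rep β U V := continuous_transferKernel_right β U
    have hKb : ∀ V, ‖transferKernel su2Rep β U V‖ ≤ M := fun V => by
      rw [Real.norm_eq_abs, abs_of_pos (transferKernel_pos su2Rep β U V)]; exact hM U V
    have hmem : MemLp (fun V => transferKernel su2Rep β U V) 2 μ :=
      MemLp.of_bound hKc.measurable.aestronglyMeasurable M (ae_of_all _ hKb)
    set x : Lp ℝ 2 μ := hmem.toLp _ with hx
    have hxae : (x : GaugeConfig 3 L SU2 → ℝ) =ᵐ[μ] fun V => transferKernel su2Rep β U V := MemLp.coeFn_toLp hmem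
    -- `⟪v j, x⟫ = λ_j e_j(U)`
    have hinner : ∀ j : Fin (k + 1), ⟪v j, x⟫_ℝ = levelValue su2Rep L β j * e j U := by
      intro j
      rw [hv, inner_toL2_left]
      calc ∫ V, (e j) V * x V ∂μ = ∫ V, transferKernel su2Rep β U V * e j V ∂μ := by
            refine integral_congr_ae ?_
            filter_upwards [hxae] with V hV
            rw [hV, mul_comm]
        _ = transferApply β (e j) U := (transferApply_apply β (e j) U).symm
        _ = levelValue su2Rep L β j * e j U := by rw [heig j]; rfl
    -- `‖x‖ ≤ M`
    have hnorm : ‖x‖ ≤ M := by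
      have h := Lp.norm_le_of_ae_bound (f := x) hM0 (by filter_upwards [hxae] with V hV; rw [hV]; exact hKb V)
      have h1 : measureUnivNNReal μ = 1 := by
        have h2 := coe_measureUnivNNReal μ
        rw [measure_univ] at h2
        exact_mod_cast h2
      rw [h1] at h
      simpa using h
    have hbessel := hvon.sum_inner_products_le (s := Finset.univ) (x := x)
    calc ∑ j : Fin (k + 1), (levelValue su2Rep L β j * e j U) ^ 2
        = ∑ j : Fin (k + 1), ‖⟪v j, x⟫_ℝ‖ ^ 2 := by
          refine Finset.sum_congr rfl fun j _ => ?_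
          rw [hinner, Real.norm_eq_abs, sq_abs]
      _ ≤ ‖x‖ ^ 2 := hbessel
      _ ≤ M ^ 2 := pow_le_pow_left₀ (norm_nonneg _) hnorm 2
  -- integrate over `U`
  have hint : ∀ j : Fin (k + 1), Integrable (fun U => (levelValue su2Rep L β j * e j U) ^ 2) μ := by
    intro j
    have h := ((he j).integrable_mul (he j)).const_mul (levelValue su2Rep L β j ^ 2)
    refine h.congr (ae_of_all _ fun U => ?_)
    simp only
    ring
  have hI : ∫ U, ∑ j : Fin (k + 1), (levelValue su2Rep L β j * e j U) ^ 2 ∂μ ≤ ∫ _U, M ^ 2 ∂μ :=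
    integral_mono (integrable_finsetSum _ fun j _ => hint j) (integrable_const _) hpt
  rw [integral_const, smul_eq_mul, hμ, probReal_univ, one_mul, integral_finsetSum _ fun j _ => hint j] at hI
  calc ∑ j : Fin (k + 1), levelValue su2Rep L β j ^ 2
      = ∑ j : Fin (k + 1), ∫ U, (levelValue su2Rep L β j * e j U) ^ 2 ∂μ := by
        refine Finset.sum_congr rfl fun j _ => ?_
        have h1 : ∫ U, (levelValue su2Rep L β j * e j U) ^ 2 ∂μ = levelValue su2Rep L β j ^ 2 * l2 (e j) (e j) := by
          unfold l2
          rw [← integral_const_mul]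
          refine integral_congr_ae (ae_of_all _ fun U => ?_)
          simp only
          ring
        rw [h1, hon]
        simp
    _ ≤ M ^ 2 := hI

/-- **Weyl-type decay**: `(k+1) · λ_k² ≤ M²` whenever `K_β ≤ M` (`β > 0`). [cite: ReedSimonI1980, Thm. VI.22] -/
theorem succ_mul_levelValue_sq_le {β : ℝ} (hβ : 0 < β) {M : ℝ} (hM : ∀ U V : GaugeConfig 3 L SU2, transferKernel su2Rep β U V ≤ M) (k : ℕ) :
    ((k : ℝ) + 1) * levelValue su2Rep L β k ^ 2 ≤ M ^ 2 := by
  have h := sum_levelValue_sq_le (L := L) hβ hM k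
  have hk0 : 0 ≤ levelValue su2Rep L β k := (levelValue_su2Rep_pos hβ k).le
  have hmono : ∀ j : Fin (k + 1), levelValue su2Rep L β k ^ 2 ≤ levelValue su2Rep L β j ^ 2 := fun j =>
    pow_le_pow_left₀ hk0 (levelValue_le_of_le hβ (Nat.le_of_lt_succ j.2)) 2
  calc ((k : ℝ) + 1) * levelValue su2Rep L β k ^ 2 = ∑ _j : Fin (k + 1), levelValue su2Rep L β k ^ 2 := by
        rw [Finset.sum_const, Finset.card_univ, Fintype.card_fin, nsmul_eq_mul]; push_cast; ring
    _ ≤ ∑ j : Fin (k + 1), levelValue su2Rep L β j ^ 2 := Finset.sum_le_sum fun j _ => hmono j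
    _ ≤ M ^ 2 := h

/-- **`λ_k(β, L) ≤ M / √(k+1)`** whenever `K_β ≤ M` (`β > 0`). [cite: ReedSimonI1980, Thm. VI.22] -/
theorem levelValue_le_div_sqrt {β : ℝ} (hβ : 0 < β) {M : ℝ} (hM : ∀ U V : GaugeConfig 3 L SU2, transferKernel su2Rep β U V ≤ M) (k : ℕ) :
    levelValue su2Rep L β k ≤ M / Real.sqrt ((k : ℝ) + 1) := by
  have hM0 : 0 ≤ M := (transferKernel_pos su2Rep β (fun _ => 1) (fun _ => 1)).le.trans (hM _ _)
  have hk0 : 0 ≤ levelValue su2Rep L β k := (levelValue_su2Rep_pos hβ k).le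
  have hk1 : (0 : ℝ) < (k : ℝ) + 1 := by positivity
  have hs : 0 < Real.sqrt ((k : ℝ) + 1) := Real.sqrt_pos.mpr hk1
  rw [le_div_iff₀ hs]
  have h := succ_mul_levelValue_sq_le (L := L) hβ hM k
  -- `(λ_k √(k+1))² = (k+1) λ_k² ≤ M²`
  have h2 : (levelValue su2Rep L β k * Real.sqrt ((k : ℝ) + 1)) ^ 2 ≤ M ^ 2 := by
    rw [mul_pow, Real.sq_sqrt hk1.le]; linarith [h]
  exact (pow_le_pow_iff_left₀ (mul_nonneg hk0 hs.le) hM0 two_ne_zero).mp h2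

/-- **The zero-flux transfer spectrum is discrete: `λ_k(β, L) → 0` as `k → ∞`** (`β > 0`, every `L ≥ 1`). [cite: ReedSimonI1980, Thm. VI.22] [cite: Luscher1977, §3] -/
theorem tendsto_levelValue_atTop_zero {β : ℝ} (hβ : 0 < β) :
    Tendsto (fun k => levelValue su2Rep L β k) atTop (𝓝 0) := by
  obtain ⟨M, hM⟩ := exists_transferKernel_le su2Rep continuous_su2Rep β (L := L)
  have hup : Tendsto (fun k : ℕ => M / Real.sqrt ((k : ℝ) + 1)) atTop (𝓝 0) := by
    have h1 : Tendsto (fun k : ℕ => Real.sqrt ((k : ℝ) + 1)) atTop atTop := by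
      refine Real.tendsto_sqrt_atTop.comp ?_
      exact tendsto_atTop_add_const_right atTop 1 tendsto_natCast_atTop_atTop
    exact h1.const_div_atTop M
  refine tendsto_of_tendsto_of_tendsto_of_le_of_le tendsto_const_nhds hup (fun k => (levelValue_su2Rep_pos hβ k).le)
    fun k => levelValue_le_div_sqrt hβ hM k

end Summit.QuantumFields.YangMills.Theorems.FemtoTransferGap

end
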